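/-
Copyright: the b2b-balaban cell (near-miss cell 7), T⁴-continuum CRUX team (coordinator ruling e34b3e0c item (2)),
row-NE7b OWNER lineage `t4-ne7b-p1` (gen 103). Released under the licence of the surrounding project.
-/
import Summits.QuantumFields.BalabanUV.T4Continuum.Support.HistoryAssemblyRealiseMult
import Summits.QuantumFields.BalabanUV.T4Continuum.Spine.NE7b.TreeBindersRel

/-!
# NE7b's COUNT EXIT WITH THE LIVE STRUCTURES READ AS PEDIGREES, RE-CUT AT THE RELATIVE KEY DISPLAY — the `_rel` twin of
# `HistoryAssemblyRealiseMult.hybridNE7_of_termReadingLE_mult` (row NE7b, IR-103-2 «count DERIVED», first level above IR-103-0)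

Crux-route work under `Spine/NE7b/` (rung (B)+1 on a FINITE torus only; NOT infinite volume, NOT the mass gap, NOT Clay;
NOT a proof of NE7b — `T4WeightBudget.RelWeightBound`, the cell's OWN estimate, NOT PRINTED, NOT PROVED).  [folklore]
COMPOSITION BY NAME of landed theorems; no definition, no `Prop` of Bałaban's minted, no `[cite:]` tag, zero `sorry`.

WHY.  Owner rulings W-ne7bp1-g103-1∕-2∕-3 (memo `t4/b2b-balaban-t4-ne7b-p1/g103/F-RHO-TOWER-g103.md` §§4, 6, 7): the (α) road's
numerator is asked AT THE PARTIAL SUM, RELATIVE to the full sum.  IR-103-0 (`…NE7b.TreeBindersRel.hybridNE7_of_treeBinders_canonLE_rel`)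
is the re-cut exit over the COARSE live classes; this file lifts it one level, to the FINE member families of the bad terms
(`gmem K τ`, e.g. the member KEYS `kmemOf …` of `HistoryAssemblyMultKey`), exactly as `HistoryAssemblyRealiseMult.hybridNE7_of_termReadingLE_mult`
lifts `HistoryAssemblyTreesLE.hybridNE7_of_treeBinders_canonLE`: the (ID) data are H3's `TermReadingLE`, the count's (E) side is the
per-member price `p` with the per-occupant multiplicity bound `hocc` (UNCHANGED — the cell's PRICE road), and the numerator is now
ONE RELATIVE display per fine family, **`fibM : Σ_{τ ∈ fibre gmem T K k} A K t τ ≤ q K k · Σ_{T K} A K t`** with the quotient priced in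
print's currency **`hPq : q K (gmem K τ) ≤ Π_{w ∈ gmem K τ} p K w`** — in place of {`upM`, `deadM_nonneg`, `resumM`, `FM_nonneg`, `nup∕Nup`,
(α), the (2.50) floor, the site budget, the (B)-side `SignConventions ∕ Cor3With`, the observable}.  The coarse display is assembled by
`TreeBindersRel.fibRel_coarse`, the slot-price bound by `HistoryAssemblyMult.hF_of_multReading` (with `FcM := 1`, `RfM := q`).
Conclusion: `HybridNE7` with weights `1 · recordsBudget (birthMass C) κ₁ n^d L^d (log 2) jhalf`.

WHAT REMAINS DISPLAYED (census).  CONSTANTS and FLOW as in the original; H3: `TermReadingLE` (the pedigrees' tree-slot data), the fine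
families with their slots (`hslots`, `hginj`), per-member prices with `hocc`, **`fibM ∕ fibM′` (RELATIVE, print's KIND at Bałaban's tower:
the partial sum over the histories carrying a given live member family, against the full sum) and `hPq ∕ hPq′` (the quotient in print's
currency)**; SEAM: `ShellWeightBound`, `ReindexedBudget`, four summable rates.  No (B)-side input at this level.
HONEST DEPENDENCY (cell): continuum YM on T⁴ ⇐ BetaPertH ∧ nine spine estimates (0/9 proved); BetaPertH ⇐ (D1) ∧ (D4) ∧
CAP+tail; G-an2-4 gates asym, D1 and NE2/3/4.  This file changes none of it.
-/

open Finset MeasureTheory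
open Literature.MathematicalPhysics.QuantumFieldTheory.Balaban1983to89
open T4PersistenceDictionary T4PersistentHistoryCount T4BankedInduction T4PrintedShapeBanking
open T4WeightBudget T4GlobalDenominator T4LiveClassFibration T4LiveStructureGas T4LiveGasToTerms T4RecordPriceSeam
open T4PartnerMultiplicity T4IndicatorShell T4MatchingAssembly T4MatchingClosure T4MatchingClosureSocket T4Continuum
open T4StabilitySocket T4BranchingRecordsGas T4TaggedShapeBanking T4CanonicalMenus T4RenewalChains
open Summit.QuantumFields.BalabanUV.T4Continuum.PlacementBatch
open Summit.QuantumFields.BalabanUV.T4Continuum.PlacementSkeleton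
open Summit.QuantumFields.BalabanUV.T4Continuum.CountThresholdUniform
open Summit.QuantumFields.BalabanUV.T4Continuum.CountThresholdExit
open Summit.QuantumFields.BalabanUV.T4Continuum.CountSeamJunction
open Summit.QuantumFields.BalabanUV.T4Continuum.LateMergers
open Summit.QuantumFields.BalabanUV.T4Continuum.HistoryFlow
open Summit.QuantumFields.BalabanUV.T4Continuum.HistoryRegeneration
open Summit.QuantumFields.BalabanUV.T4Continuum.HistoryTables
open Summit.QuantumFields.BalabanUV.T4Continuum.HistoryAssemblyTrees
open Summit.QuantumFields.BalabanUV.T4Continuum.HistoryAssemblyTerms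
open Summit.QuantumFields.BalabanUV.T4Continuum.HistoryAssemblyPedigree
open Summit.QuantumFields.BalabanUV.T4Continuum.HistoryConstants
open Summit.QuantumFields.BalabanUV.T4Continuum.HistoryGen
open Summit.QuantumFields.BalabanUV.T4Continuum.ZoneSkeleton
open Summit.QuantumFields.BalabanUV.T4Continuum.HistorySocketTH
open Summit.QuantumFields.BalabanUV.T4Continuum.HistoryCaps
open Summit.QuantumFields.BalabanUV.T4Continuum.HistoryAssemblyPrice
open Summit.QuantumFields.BalabanUV.T4Continuum.HistoryBankingLE
open Summit.QuantumFields.BalabanUV.T4Continuum.HistoryExitLE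
open Summit.QuantumFields.BalabanUV.T4Continuum.HistoryAssemblyTreesLE
open Summit.QuantumFields.BalabanUV.T4Continuum.HistoryAssemblyTermsLE
open Summit.QuantumFields.BalabanUV.T4Continuum.HistoryRealise
open Summit.QuantumFields.BalabanUV.T4Continuum.HistoryAssemblyRealiseLE
open Summit.QuantumFields.BalabanUV.T4Continuum.HistoryAssemblyMult
open Summit.QuantumFields.BalabanUV.T4Continuum.HistoryAssemblyMultKey
open Summit.QuantumFields.BalabanUV.T4Continuum.HistoryAssemblyRealiseMult
open Summit.QuantumFields.BalabanUV.T4Continuum.NE7b.PinnedExtraction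
open Summit.QuantumFields.BalabanUV.T4Continuum.NE7b.TreeBindersRel

namespace Summit.QuantumFields.BalabanUV.T4Continuum.NE7b.TermReadingRel

noncomputable section

/-- the coarse quotient `RfC … 1 q` is non-negative when the fine quotients are [folklore] -/
theorem RfC_one_nonneg {γ ε' ι' ω' : Type*} [DecidableEq γ] [DecidableEq ω'] {mem : ℕ → ι' → Finset (γ × Gen ε')}
    {jstar : ℕ → ℕ} {T' : ℕ → Finset ι'} {gmem : ℕ → ι' → Finset ω'} {gslot : ω' → BSlot γ PEv}
    {q : ℕ → Finset ω' → ℝ} {K : ℕ} (hq : ∀ k ∈ badGMems mem jstar T' gmem K, 0 ≤ q K k) (c : Finset (BSlot γ PEv)) :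
    0 ≤ RfC mem jstar T' gmem gslot (fun _ _ => 1) q K c := by
  unfold RfC
  exact sum_nonneg fun k hk => by rw [one_mul]; exact hq k (mem_filter.1 hk).1

section Terms

variable {F : T4Family} {G : Type*} [GaugeGroup G] [MeasurableSpace G] [HaarData G]
variable {ε : Type*} [DecidableEq ε] {ω : Type*} [DecidableEq ω]
variable {ι : Type*} [DecidableEq ι] {l₀ vol : ℝ} {K₀ : ℕ} {T : ℕ → Finset ι} {A A' shA shB : ℕ → ℝ → ι → ℝ}
  {Cc Rr CcRec RrRec : ℕ → ℝ → ι → ℝ} {ν u s₂ q₀ r s Wsh : ℕ → ℝ}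

/-- **NE7b's COUNT EXIT WITH LIVE PEDIGREES, FINE MEMBER FAMILIES, AND A RELATIVE NUMERATOR DISPLAY PER FAMILY** (the `_rel`
twin of `HistoryAssemblyRealiseMult.hybridNE7_of_termReadingLE_mult`): H3's `TermReadingLE` over the terms' named members (the tree-slot
(ID) binders BY NAME: `hlabTLE_of_termReadingLE`, `hstr_of_termReadingLE`), the FINE member families `gmem K τ` with slots `gslot`
(`hslots`, `hginj`), per-member prices `p ∕ p′` with the per-occupant multiplicity bound `hocc ∕ hocc′` (the placement sum is taken in the
kernel by `hF_of_multReading`), the RELATIVE displays `fibM ∕ fibM′` per fine family with quotients `q ∕ q′ ≥ 0` priced by `hPq ∕ hPq′`,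
non-negative weights on `T K`; then `TreeBindersRel.hybridNE7_of_treeBinders_canonLE_rel` over the coarse classes with
`Fq := RfC … 1 q` (`TreeBindersRel.fibRel_coarse`).  No envelope, no floor, no (B)-side input. [folklore] -/
theorem hybridNE7_of_termReadingLE_mult_rel (D : FiniteEpsData F G) (sh : ε → PEv) {C : T4PrintedShapeBanking.Consts}
    {rr : ℕ} {β₀ : ℝ} (h : ThresholdOK C F.L rr β₀) (hμ : 0 < C.μ) (d n : ℕ) (Dcap Ncap : ℕ → ℕ)
    (hκ₁ : (d : ℝ) * Real.log F.L + 2 * Real.log 2 ≤ C.κ₁) (hE₀ : Real.log (2 + birthMass C) ≤ C.E₀)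
    -- the flow side (⇐ BetaPertH, displayed) and tuning
    {γ₀ γb b β' : ℝ} {pe : ℕ} (hb : 0 ≤ b) (hlo : FlowStep.BetaLowerH b γ₀ D.βfun)
    (hhi : FlowStep.BetaUpperH β' γ₀ D.βfun) (hγ : γb ≤ γ₀) (hγβ : γb ^ 2 * β' < 1)
    (S : B14FlowStep.SmallnessFor γb β' β₀ F.L pe) (hp₀ : C.p₀ ≤ pe) (hrr : rr ≤ pe)
    {g : ℝ} {g₀ : ℕ → ℝ} (ht : D.Tuned γb g g₀)
    (hir : irThresholdTLE C F.L rr β₀ ≤ Real.log (g ^ 2)⁻¹)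
    -- the (2.5) side condition on the size function
    (R : ℕ → ℕ → ℕ) (hR : ∀ K s, s ≤ K → B14.IsRj F.L rr ((D.C ⟨K, F.m, g₀ K⟩).flow.g s) (R K s))
    -- H3, PER TERM: the live members of the terms and their reading
    (mem : ℕ → ι → Finset ((Fin d → ℕ) × Gen ε))
    (H : TermReadingLE sh C (cellN d n F.L) Dcap Ncap jhalf K₀ R T mem)
    -- the FINE member families and their slots (displayed compatibilities with the live classes)
    (gmem : ℕ → ι → Finset ω) (gslot : ω → BSlot (Fin d → ℕ) PEv)
    (hslots : ∀ K, K₀ ≤ K → ∀ τ ∈ T K, (gmem K τ).image gslot = bstrOf sh mem K τ)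
    (hginj : ∀ K, K₀ ≤ K → ∀ τ ∈ badTerms mem jhalf T K, Set.InjOn gslot (gmem K τ : Set ω))
    -- a nonnegative per-member price for each run, and THE PER-OCCUPANT MULTIPLICITY BOUND at every tree slot
    (p p' : ℕ → ω → ℝ) (hp : ∀ K w, 0 ≤ p K w) (hp' : ∀ K w, 0 ≤ p' K w)
    (hocc : ∀ K, K₀ ≤ K → ∀ s, ∀ w ∈ gocc mem jhalf T gmem gslot K s,
      ((gocc mem jhalf T gmem gslot K s).card : ℝ) * p K w ≤
        bslotPrice (yT sh C ((F.L : ℝ) ^ d) R (fun K => (D.C ⟨K, F.m, g₀ K⟩).flow.g) mem jhalf T K) s)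
    (hocc' : ∀ K, K₀ ≤ K → ∀ s, ∀ w ∈ gocc mem jhalf T gmem gslot K s,
      ((gocc mem jhalf T gmem gslot K s).card : ℝ) * p' K w ≤
        bslotPrice (yT sh C ((F.L : ℝ) ^ d) R (fun K => (D.C ⟨K, F.m, g₀ K⟩).flow.g) mem jhalf T K) s)
    -- H3, RE-CUT: non-negative weights; ONE RELATIVE DISPLAY PER FINE FAMILY of the bad terms, both runs, with non-negative quotients
    -- priced in print's currency by the member prices
    (hA0 : ∀ K t, |t| ≤ l₀ → K₀ ≤ K → ∀ τ ∈ T K, 0 ≤ A K t τ)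
    (hA0' : ∀ K t, |t| ≤ l₀ → K₀ ≤ K → ∀ τ ∈ T K, 0 ≤ A' K t τ)
    {q q' : ℕ → Finset ω → ℝ}
    (hq : ∀ K, K₀ ≤ K → ∀ k ∈ badGMems mem jhalf T gmem K, 0 ≤ q K k)
    (hq' : ∀ K, K₀ ≤ K → ∀ k ∈ badGMems mem jhalf T gmem K, 0 ≤ q' K k)
    (fibM : ∀ K t, |t| ≤ l₀ → K₀ ≤ K → ∀ k ∈ badGMems mem jhalf T gmem K,
      ∑ τ ∈ fibre gmem T K k, A K t τ ≤ q K k * ∑ σ ∈ T K, A K t σ)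
    (fibM' : ∀ K t, |t| ≤ l₀ → K₀ ≤ K → ∀ k ∈ badGMems mem jhalf T gmem K,
      ∑ τ ∈ fibre gmem T K k, A' K t τ ≤ q' K k * ∑ σ ∈ T K, A' K t σ)
    (hPq : ∀ K t, |t| ≤ l₀ → K₀ ≤ K → ∀ τ ∈ badTerms mem jhalf T K, q K (gmem K τ) ≤ ∏ w ∈ gmem K τ, p K w)
    (hPq' : ∀ K t, |t| ≤ l₀ → K₀ ≤ K → ∀ τ ∈ badTerms mem jhalf T K, q' K (gmem K τ) ≤ ∏ w ∈ gmem K τ, p' K w)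
    -- the seam's other inputs
    (hSh : ShellWeightBound l₀ T A A' shA shB Wsh)
    (hTB : ReindexedBudget l₀ vol T (fun K t τ => A K t τ - shA K t τ) (fun K t τ => A' K t τ - shB K t τ)
      (badOfClass (bstrOf sh mem) T (fun K _ => badClasses sh mem jhalf T K)) Cc Rr CcRec RrRec ν u s₂ q₀ r s)
    (hr : Summable r) (hu : Summable u) (hs : Summable s) (hs₂ : Summable s₂) :
    ∃ K₁ K₂, K₀ ≤ K₁ ∧ HybridNE7 l₀ vol (fun K => T (K₁ + (K₂ + K))) (fun K => A (K₁ + (K₂ + K)))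
      (fun K => A' (K₁ + (K₂ + K)))
      (fun K => badOfClass (bstrOf sh mem) T (fun K _ => badClasses sh mem jhalf T K) (K₁ + (K₂ + K)))
      (fun K => 1 * recordsBudget (birthMass C) C.κ₁ ((n : ℝ) ^ d) ((F.L : ℝ) ^ d) (Real.log 2) jhalf (K₁ + (K₂ + K)))
      (fun K => shA (K₁ + (K₂ + K))) (fun K => shB (K₁ + (K₂ + K))) (fun K => Wsh (K₁ + (K₂ + K)))
      (fun K => (r (K₁ + (K₂ + K)) + u (K₁ + (K₂ + K))) + (s (K₁ + (K₂ + K)) + s₂ (K₁ + (K₂ + K)))) := by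
  have hLpos : (0 : ℝ) < F.L := by exact_mod_cast (lt_of_lt_of_le (by norm_num) (two_le_L F))
  have hΛ : (0 : ℝ) ≤ (F.L : ℝ) ^ d := pow_nonneg hLpos.le d
  -- the member prices in the `FcM·RfM` form `hF_of_multReading` wants (`FcM := 1`, `RfM := q`)
  have hPM : ∀ K t, |t| ≤ l₀ → K₀ ≤ K → ∀ τ ∈ badTerms mem jhalf T K,
      (1 : ℝ) * q K (gmem K τ) ≤ ∏ w ∈ gmem K τ, p K w := fun K t ht hK τ hτ => by
    rw [one_mul]; exact hPq K t ht hK τ hτ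
  have hPM' : ∀ K t, |t| ≤ l₀ → K₀ ≤ K → ∀ τ ∈ badTerms mem jhalf T K,
      (1 : ℝ) * q' K (gmem K τ) ≤ ∏ w ∈ gmem K τ, p' K w := fun K t ht hK τ hτ => by
    rw [one_mul]; exact hPq' K t ht hK τ hτ
  exact hybridNE7_of_treeBinders_canonLE_rel D sh h hμ d n Dcap Ncap hκ₁ hE₀ hb hlo hhi hγ hγβ S hp₀ hrr ht hir
    (π := bstrOf sh mem) (Bad' := fun K _ => badClasses sh mem jhalf T K)
    (Fq := RfC mem jhalf T gmem gslot (fun _ _ => (1 : ℝ)) q) (Fq' := RfC mem jhalf T gmem gslot (fun _ _ => (1 : ℝ)) q')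
    (fun K _ _ _ => badClasses_subset_classIndex sh mem jhalf T K) hA0 hA0'
    (fun K _ _ hK c _ => RfC_one_nonneg (hq K hK) c) (fun K _ _ hK c _ => RfC_one_nonneg (hq' K hK) c)
    (fibRel_coarse hslots fibM) (fibRel_coarse hslots fibM') R hR
    (yT sh C ((F.L : ℝ) ^ d) R (fun K => (D.C ⟨K, F.m, g₀ K⟩).flow.g) mem jhalf T)
    (fun K j _ z _ Gs _ => yT_nonneg hΛ K j z Gs)
    (fun K hK j hj z hz Gs hGs => hlabTLE_of_termReadingLE H (canonFam Dcap Ncap) K hK j hj z hz Gs hGs)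
    (fun _ c => c) (fun K t _ _ => Set.injOn_id _)
    (fun K t _ hK c hc => hstr_of_termReadingLE H K hK hc)
    (fun K t ht hK cl hcl => by
      have h1 := hF_of_multReading (FcM := fun _ _ => (1 : ℝ)) (RfM := q) hΛ hginj hp hocc hPM K t ht hK cl hcl
      rwa [one_mul] at h1)
    (fun K t ht hK cl hcl => by
      have h1 := hF_of_multReading (FcM := fun _ _ => (1 : ℝ)) (RfM := q') hΛ hginj hp' hocc' hPM' K t ht hK cl hcl
      rwa [one_mul] at h1)
    hSh hTB hr hu hs hs₂

end Terms

end

end Summit.QuantumFields.BalabanUV.T4Continuum.NE7b.TermReadingRel
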